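import Mathlib
import Literature.NumberTheory.LFunctions.Zhang2022.Section17NuOneStarBelowCutoff
import HarnessLib

/-!
# Zhang (2022) §17: below the cutoff, `ν₁*(v) = ν⁻(v) + [D⁴-tail] + O(δ·(ν²∗τ₂)(v))`, `ν⁻ = μχ ∗ 1`

Topic `Literature/NumberTheory/LFunctions/Zhang2022` (Landau–Siegel audit tree; verdict-neutral).
Y. Zhang, *Discrete mean estimates and the Landau–Siegel zero*, arXiv:2211.02515v1 (2022)
[Zhang2022LandauSiegel] — **an unrefereed manuscript under adjudication**; nothing here asserts or denies
its Theorems 1–2. §17 pp. 97–98 (u014, u021), §3 p. 6 (`υ = μ ∗ μχ`, `υ ∗ 1 ∗ 1 = μχ ∗ 1 =: ν⁻`).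
Decomposition-independent tools for the §17.u021 remainder `R₁` (WP16 leaf h17_9; MEMO-R1-window §2(i):
"`ν₁*(v) = c(v) + O(…)`, `c(v) := Σ_{a∣v,a≤D⁴} υ(a)τ₂(v/a) = ν⁻(v) − Σ_{a∣v, a>D⁴} υ(a)τ₂(v/a)`"):

* `sum_antidiag_ups_mul_tau_eq_nuMinus` — `Σ_{v=ab} υ(a)τ₂(b) = Σ_{d∣v} μ(d)χ(d)` (`υ ∗ 1 ∗ 1 = μχ ∗ 1`,
  the tree's `sum_sum_ups_eq` re-indexed);
* `truncMain_eq_nuMinus_sub_tail` — `Σ_{v=ab, a≤D⁴} υ(a)τ₂(b) = ν⁻(v) − Σ_{v=ab, a>D⁴} υ(a)τ₂(b)`;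
* `norm_truncTail_tau_le` — `‖Σ_{v=ab, a>D⁴} υ(a)τ₂(b)‖ ≤ Σ_{v=ab, a>D⁴} |ν(a)|²τ₂(b)` (`|υ| ≤ ν²`);
* `norm_ups_le_norm_nu` — `|υ(n)| ≤ |ν(n)|` (linear majorant); `norm_nuOneStar_sub_truncMain_le_linear`,
  `norm_nuOneStar_sub_nuMinus_le_linear` — the same with the perturbation weight `|ν(a)|τ₂(b)`;
* `norm_nuOneStar_sub_nuMinus_le` — for a real `χ`, `𝓛 ≥ 3`, `|c′α𝓛| ≤ 1/14`, `4v ≤ T²`: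
  `‖ν₁*(v) − ν⁻(v)‖ ≤ Σ_{v=ab, a>D⁴} |ν(a)|²τ₂(b) + 2δ·Σ_{v=ab, a≤D⁴} |ν(a)|²τ₂(b)`
  (`δ = 10α𝓛^{11/10} + ½e^{−𝓛³⁰}`; the first sum is what Lemma 3.1 / 3.2♭ (long range) make negligible
  after summation, since `a > D⁴`; the second is the `F`-type perturbation).

Theorems only (no definitions, no named facts); axioms standard. WHAT THIS IS NOT: a bound for `R₁`;
any claim about Theorems 1–2 of the source or about Landau–Siegel zeros.

## References

* Y. Zhang, arXiv:2211.02515v1 (2022), §3 p. 6, §17 pp. 97–98. [cite: Zhang2022LandauSiegel, §17 u021 p.98]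
-/

noncomputable section

open Complex Real Finset ArithmeticFunction
open Literature.NumberTheory.LFunctions.Zhang2022.Skeleton
open Literature.NumberTheory.LFunctions.Zhang2022.Typed.Section17
open Literature.NumberTheory.LFunctions.Zhang2022.MeanSquareMajorant

namespace Literature.NumberTheory.LFunctions.Zhang2022.Phi3Eval

variable (c' : ℝ) {D : ℕ} (χ : DirichletCharacter ℂ D)

/-- `τ₂(n)` as a complex double count: `(τ₂(n) : ℂ) = Σ_{n = bc} 1`. [cite: Zhang2022LandauSiegel, §17 u021 p.98] -/
theorem tau_two_cast_eq_sum_antidiag (n : ℕ) :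
    (tau 2 n : ℂ) = ∑ _y ∈ n.divisorsAntidiagonal, (1 : ℂ) := by
  rw [← card_antidiag_eq_tau_two]; push_cast; rfl

/-- **`υ ∗ τ₂ = ν⁻`**: `Σ_{v=ab} υ(a)τ₂(b) = Σ_{d∣v} μ(d)χ(d)` (the tree's `sum_sum_ups_eq`, re-indexed through
the associativity of Dirichlet convolution). [cite: Zhang2022LandauSiegel, §3 p.6] -/
theorem sum_antidiag_ups_mul_tau_eq_nuMinus (v : ℕ) :
    ∑ q ∈ v.divisorsAntidiagonal, ups χ q.1 * (tau 2 q.2 : ℂ) =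
      ∑ d ∈ v.divisors, (ArithmeticFunction.moebius d : ℂ) * χ (d : ZMod D) := by
  classical
  rw [← sum_sum_ups_eq χ v]
  set U := toArithmeticFunction (ups χ) with hU
  set Z : ArithmeticFunction ℂ := (ArithmeticFunction.zeta : ArithmeticFunction ℂ) with hZ
  have hZapp : ∀ {k : ℕ}, k ≠ 0 → Z k = 1 := fun {k} hk => by
    rw [hZ, ArithmeticFunction.natCoe_apply, ArithmeticFunction.zeta_apply_ne hk]; simp
  have hUapp : ∀ {k : ℕ}, k ≠ 0 → U k = ups χ k := fun {k} hk => by simp [hU, toArithmeticFunction, hk]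
  -- left side = (U * (Z * Z)) v
  have hL : ∑ q ∈ v.divisorsAntidiagonal, ups χ q.1 * (tau 2 q.2 : ℂ) = (U * (Z * Z)) v := by
    rw [ArithmeticFunction.mul_apply]
    refine Finset.sum_congr rfl fun q hq => ?_
    obtain ⟨hq1, hq2, -, -⟩ := bounds_of_mem_antidiag hq
    rw [hUapp hq1, tau_two_cast_eq_sum_antidiag, ArithmeticFunction.mul_apply]
    congr 1
    refine Finset.sum_congr rfl fun y hy => ?_
    obtain ⟨hy1, hy2, -, -⟩ := bounds_of_mem_antidiag hy
    rw [hZapp hy1, hZapp hy2, mul_one]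
  -- right side = ((U * Z) * Z) v
  have hR : ∑ x ∈ v.divisorsAntidiagonal, ∑ y ∈ x.1.divisorsAntidiagonal, ups χ y.1 = ((U * Z) * Z) v := by
    rw [ArithmeticFunction.mul_apply]
    refine Finset.sum_congr rfl fun x hx => ?_
    obtain ⟨hx1, hx2, -, -⟩ := bounds_of_mem_antidiag hx
    rw [hZapp hx2, mul_one, ArithmeticFunction.mul_apply]
    refine Finset.sum_congr rfl fun y hy => ?_
    obtain ⟨hy1, hy2, -, -⟩ := bounds_of_mem_antidiag hy
    rw [hUapp hy1, hZapp hy2, mul_one]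
  rw [hL, hR, mul_assoc]

/-- **The truncated main part**: `Σ_{v=ab, a≤D⁴} υ(a)τ₂(b) = ν⁻(v) − Σ_{v=ab, a>D⁴} υ(a)τ₂(b)`.
[cite: Zhang2022LandauSiegel, §17 u021 p.98] -/
theorem truncMain_eq_nuMinus_sub_tail (v : ℕ) :
    ∑ q ∈ v.divisorsAntidiagonal with q.1 ≤ D ^ 4, ups χ q.1 * (tau 2 q.2 : ℂ) =
      (∑ d ∈ v.divisors, (ArithmeticFunction.moebius d : ℂ) * χ (d : ZMod D)) -
        ∑ q ∈ v.divisorsAntidiagonal with D ^ 4 < q.1, ups χ q.1 * (tau 2 q.2 : ℂ) := by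
  classical
  rw [← sum_antidiag_ups_mul_tau_eq_nuMinus χ v, eq_sub_iff_add_eq]
  have h := Finset.sum_filter_add_sum_filter_not v.divisorsAntidiagonal (fun q => q.1 ≤ D ^ 4)
    (fun q => ups χ q.1 * (tau 2 q.2 : ℂ))
  simp only [not_le] at h
  exact h

/-- The truncation tail with `τ₂` is majorised by `ν²`: `‖Σ_{v=ab, a>D⁴} υ(a)τ₂(b)‖ ≤ Σ_{v=ab, a>D⁴} |ν(a)|²τ₂(b)`.
[cite: Zhang2022LandauSiegel, §17 u021 p.98] -/
theorem norm_truncTail_tau_le (hq : χ.IsQuadratic) (v : ℕ) :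
    ‖∑ q ∈ v.divisorsAntidiagonal with D ^ 4 < q.1, ups χ q.1 * (tau 2 q.2 : ℂ)‖ ≤
      ∑ q ∈ v.divisorsAntidiagonal with D ^ 4 < q.1, ‖nu χ q.1‖ ^ 2 * tau 2 q.2 := by
  refine (norm_sum_le _ _).trans (Finset.sum_le_sum fun q _ => ?_)
  rw [norm_mul, Complex.norm_real, Real.norm_eq_abs, abs_of_nonneg (tau_nonneg _ _)]
  exact mul_le_mul_of_nonneg_right (norm_ups_le_norm_nu_sq χ hq q.1) (tau_nonneg _ _)

/-- **`ν₁*(v) = ν⁻(v) + O(tail) + O(δ·(ν²∗τ₂)(v))` below the cutoff**: for a real `χ`, `𝓛 ≥ 3`,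
`|c′α𝓛| ≤ 1/14` and `4v ≤ T²`,
`‖ν₁*(v) − Σ_{d∣v} μ(d)χ(d)‖ ≤ Σ_{v=ab, a>D⁴} |ν(a)|²τ₂(b) + 2δ·Σ_{v=ab, a≤D⁴} |ν(a)|²τ₂(b)`,
`δ = 10α𝓛^{11/10} + ½e^{−𝓛³⁰}`. [cite: Zhang2022LandauSiegel, §17 u021 p.98] -/
theorem norm_nuOneStar_sub_nuMinus_le (hq : χ.IsQuadratic) (hℓ : 3 ≤ ell D)
    (hc : |c' * alpha D * ell D| ≤ 1 / 14) {v : ℕ} (hvT : 4 * (v : ℝ) ≤ bigT D ^ 2) :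
    ‖nuOneStar c' χ v - ∑ d ∈ v.divisors, (ArithmeticFunction.moebius d : ℂ) * χ (d : ZMod D)‖ ≤
      (∑ q ∈ v.divisorsAntidiagonal with D ^ 4 < q.1, ‖nu χ q.1‖ ^ 2 * tau 2 q.2) +
        2 * (10 * alpha D * ell D ^ (11 / 10 : ℝ) + (1 / 2 : ℝ) * Real.exp (-(ell D ^ 30))) *
          ∑ q ∈ v.divisorsAntidiagonal with q.1 ≤ D ^ 4, ‖nu χ q.1‖ ^ 2 * tau 2 q.2 := by
  classical
  set M := ∑ q ∈ v.divisorsAntidiagonal with q.1 ≤ D ^ 4, ups χ q.1 * (tau 2 q.2 : ℂ) with hM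
  set Tl := ∑ q ∈ v.divisorsAntidiagonal with D ^ 4 < q.1, ups χ q.1 * (tau 2 q.2 : ℂ) with hTl
  have hmain : ∑ d ∈ v.divisors, (ArithmeticFunction.moebius d : ℂ) * χ (d : ZMod D) = M + Tl := by
    rw [hM, truncMain_eq_nuMinus_sub_tail χ v, sub_add_cancel]
  have h1 := norm_nuOneStar_sub_truncMain_le c' χ hq hℓ hc hvT
  have h2 := norm_truncTail_tau_le χ hq v
  rw [← hM] at h1
  rw [← hTl] at h2
  rw [hmain]
  calc ‖nuOneStar c' χ v - (M + Tl)‖ = ‖(nuOneStar c' χ v - M) + (-Tl)‖ := by ring_nf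
    _ ≤ ‖nuOneStar c' χ v - M‖ + ‖-Tl‖ := norm_add_le _ _
    _ ≤ _ := by rw [norm_neg, add_comm]; exact add_le_add h2 h1

/-! ## The linear majorant `|υ| ≤ ν` and the perturbation with weight `ν` (not `ν²`) -/

/-- **`|υ(n)| ≤ |ν(n)|`** for a real character (prime powers: `|1+χ(p)| = ν(p)`, `|χ(p)| ≤ ν(p²)`, `0`).
[cite: Zhang2022LandauSiegel, §3 p.6] -/
theorem norm_ups_le_norm_nu (hq : χ.IsQuadratic) (n : ℕ) : ‖ups χ n‖ ≤ ‖nu χ n‖ := by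
  induction n using Nat.recOnPosPrimePosCoprime with
  | zero => simp [ups, LSeries.convolution]
  | one => rw [ups_one, nu, divisorSumChar_one]
  | prime_pow p k hp hk =>
    obtain ⟨k, rfl⟩ := Nat.exists_eq_succ_of_ne_zero hk.ne'
    rw [ups_prime_pow_succ χ hp k, nu, divisorSumChar_prime_pow χ hp, geomPartialSum]
    rcases hq (p : ZMod D) with h | h | h <;> rw [h]
    · split_ifs <;> simp [Finset.sum_range_succ']
    · rcases k with _ | _ | k
      · norm_num [Finset.sum_range_succ]
      · norm_num [Finset.sum_range_succ]
      · simp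
    · rcases k with _ | _ | k
      · simp
      · norm_num [Finset.sum_range_succ]
      · simp
  | coprime a b ha hb hab iha ihb =>
    rw [ups_mul_of_coprime χ (by omega) (by omega) hab, nu, divisorSumChar_mul_of_coprime χ hab, norm_mul,
      norm_mul]
    exact mul_le_mul iha ihb (norm_nonneg _) (norm_nonneg _)

/-- The perturbation with the LINEAR weight: for `4v ≤ T²` and a real `χ`,
`‖ν₁*(v) − Σ_{v=ab, a≤D⁴} υ(a)τ₂(b)‖ ≤ 2δ·Σ_{v=ab, a≤D⁴} |ν(a)|τ₂(b)` (`|υ| ≤ ν`; the outer count of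
this weight has prime value `ν(p)(4 + ν(p)) = 12` at split primes, i.e. `𝓛¹²` against `δ·θ′ ≍ 𝓛^{−15.8}`).
[cite: Zhang2022LandauSiegel, §17 u021 p.98] -/
theorem norm_nuOneStar_sub_truncMain_le_linear (hq : χ.IsQuadratic) (hℓ : 3 ≤ ell D)
    (hc : |c' * alpha D * ell D| ≤ 1 / 14) {v : ℕ} (hvT : 4 * (v : ℝ) ≤ bigT D ^ 2) :
    ‖nuOneStar c' χ v -
        ∑ q ∈ v.divisorsAntidiagonal with q.1 ≤ D ^ 4, ups χ q.1 * (tau 2 q.2 : ℂ)‖ ≤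
      2 * (10 * alpha D * ell D ^ (11 / 10 : ℝ) + (1 / 2 : ℝ) * Real.exp (-(ell D ^ 30))) *
        ∑ q ∈ v.divisorsAntidiagonal with q.1 ≤ D ^ 4, ‖nu χ q.1‖ * tau 2 q.2 := by
  classical
  set δ : ℝ := 10 * alpha D * ell D ^ (11 / 10 : ℝ) + (1 / 2 : ℝ) * Real.exp (-(ell D ^ 30)) with hδ
  set W := LSeries.convolution (nN D (beta2 c' D)) (nN D (beta3 c' D)) with hW
  have hassoc : nuOneStar c' χ = LSeries.convolution (trunc (D ^ 4) (ups χ)) W := by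
    rw [nuOneStar, hW]
    show ⇑(toArithmeticFunction ⇑(toArithmeticFunction
        (trunc (D ^ 4) (ups χ)) * toArithmeticFunction (nN D (beta2 c' D))) *
        toArithmeticFunction (nN D (beta3 c' D))) =
      ⇑(toArithmeticFunction (trunc (D ^ 4) (ups χ)) *
        toArithmeticFunction ⇑(toArithmeticFunction (nN D (beta2 c' D)) *
          toArithmeticFunction (nN D (beta3 c' D))))
    rw [ArithmeticFunction.toArithmeticFunction_eq_self,
      ArithmeticFunction.toArithmeticFunction_eq_self, mul_assoc]
  have hexp : nuOneStar c' χ v = ∑ q ∈ v.divisorsAntidiagonal with q.1 ≤ D ^ 4, ups χ q.1 * W q.2 := by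
    rw [hassoc, LSeries.convolution_def]
    simp only
    rw [Finset.sum_filter]
    refine Finset.sum_congr rfl fun q _ => ?_
    simp only [trunc]
    split_ifs <;> simp
  rw [hexp, ← Finset.sum_sub_distrib, Finset.mul_sum]
  refine (norm_sum_le _ _).trans (Finset.sum_le_sum fun q hqm => ?_)
  have hq' := (Finset.mem_filter.1 hqm).1
  obtain ⟨hq1, hq2, _, hq2v'⟩ := bounds_of_mem_antidiag hq'
  have hq2v : (q.2 : ℝ) ≤ v := by exact_mod_cast hq2v'
  have hWτ := norm_conv_nN_nN_sub_tau_le c' hℓ hc (k := q.2) (by linarith)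
  rw [← hW, ← hδ] at hWτ
  rw [← mul_sub, norm_mul]
  have hδ0 : 0 ≤ 2 * δ * tau 2 q.2 := le_trans (norm_nonneg _) hWτ
  calc ‖ups χ q.1‖ * ‖W q.2 - (tau 2 q.2 : ℂ)‖ ≤ ‖nu χ q.1‖ * (2 * δ * tau 2 q.2) :=
        mul_le_mul (norm_ups_le_norm_nu χ hq q.1) hWτ (norm_nonneg _) (norm_nonneg _)
    _ = 2 * δ * (‖nu χ q.1‖ * tau 2 q.2) := by ring

/-- **`ν₁*(v) = ν⁻(v) + O(tail) + O(δ·(ν∗τ₂)(v))` below the cutoff, linear weight**: for a real `χ`,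
`𝓛 ≥ 3`, `|c′α𝓛| ≤ 1/14`, `4v ≤ T²`:
`‖ν₁*(v) − Σ_{d∣v} μ(d)χ(d)‖ ≤ Σ_{v=ab, a>D⁴} |ν(a)|²τ₂(b) + 2δ·Σ_{v=ab, a≤D⁴} |ν(a)|τ₂(b)`.
[cite: Zhang2022LandauSiegel, §17 u021 p.98] -/
theorem norm_nuOneStar_sub_nuMinus_le_linear (hq : χ.IsQuadratic) (hℓ : 3 ≤ ell D)
    (hc : |c' * alpha D * ell D| ≤ 1 / 14) {v : ℕ} (hvT : 4 * (v : ℝ) ≤ bigT D ^ 2) :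
    ‖nuOneStar c' χ v - ∑ d ∈ v.divisors, (ArithmeticFunction.moebius d : ℂ) * χ (d : ZMod D)‖ ≤
      (∑ q ∈ v.divisorsAntidiagonal with D ^ 4 < q.1, ‖nu χ q.1‖ ^ 2 * tau 2 q.2) +
        2 * (10 * alpha D * ell D ^ (11 / 10 : ℝ) + (1 / 2 : ℝ) * Real.exp (-(ell D ^ 30))) *
          ∑ q ∈ v.divisorsAntidiagonal with q.1 ≤ D ^ 4, ‖nu χ q.1‖ * tau 2 q.2 := by
  classical
  set M := ∑ q ∈ v.divisorsAntidiagonal with q.1 ≤ D ^ 4, ups χ q.1 * (tau 2 q.2 : ℂ) with hM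
  set Tl := ∑ q ∈ v.divisorsAntidiagonal with D ^ 4 < q.1, ups χ q.1 * (tau 2 q.2 : ℂ) with hTl
  have hmain : ∑ d ∈ v.divisors, (ArithmeticFunction.moebius d : ℂ) * χ (d : ZMod D) = M + Tl := by
    rw [hM, truncMain_eq_nuMinus_sub_tail χ v, sub_add_cancel]
  have h1 := norm_nuOneStar_sub_truncMain_le_linear c' χ hq hℓ hc hvT
  have h2 := norm_truncTail_tau_le χ hq v
  rw [← hM] at h1
  rw [← hTl] at h2
  rw [hmain]
  calc ‖nuOneStar c' χ v - (M + Tl)‖ = ‖(nuOneStar c' χ v - M) + (-Tl)‖ := by ring_nf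
    _ ≤ ‖nuOneStar c' χ v - M‖ + ‖-Tl‖ := norm_add_le _ _
    _ ≤ _ := by rw [norm_neg, add_comm]; exact add_le_add h2 h1

end Literature.NumberTheory.LFunctions.Zhang2022.Phi3Eval
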